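import Literature.AnabelianGeometry.EtaleTheta.Discharge.Sec2LiftingSurjProofs
import Literature.AnabelianGeometry.EtaleTheta.Discharge.Sec2CyclotomicCharacterProofs

/-!
# [EtTh] Prop 2.14 (iii) (existence half) / Cor 2.18 (iv) (surjectivity), PER AUTOMORPHISM: a
# theta-stabilising bi-continuous automorphism of `Π^tp_X` lifts to an automorphism of the model
# mono-theta environment `M(η)` (proof-only companion)

Mochizuki, *The Étale Theta Function and its Frobenioid-theoretic Manifestations* [EtTh], Publ. RIMS 45
(2009), §2, Prop 2.14 (iii) pp.49–50, Cor 2.18 (iv) pp.61–62 (locators `p.N` = PDF pages of the PRIMS text;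
bib key `MochizukiEtTh2009`). PROOF-ONLY companion (no `def`) of `ThetaRigidity.lean` / `MonoThetaEnv.lean`
(seat abc-iut-L2-t2, §2 owner): the construction of abc-iut-L2-t10's `RigidData.cor218_iv_surjective_of`
(`Discharge/Sec2LiftingSurjProofs.lean`, hypotheses quantified over ALL automorphisms of `Π^tp_X`: Cor 2.18 (i)
and constant multiple rigidity for every `γ`) LOCALISED to ONE automorphism — the form needed by a consumer
holding a single automorphism: the `Gal(Y/X)`-translations and the inversion of Prop 2.14 (iii) ("this
automorphism induces an automorphism `∈ (l·ℤ) ⋊ {±1}` … `Aut(M) → (l·ℤ) ⋊ {±1}` is surjective", pp.49–50),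
[IUTchII]'s pointed inversions.
* `ThetaEnvData.exists_monoIso_over_aut` — for `φ ∈ Aut_top(Π^tp_X)` with `φ(Π^tp_Y) = Π^tp_Y`,
  `φ(Π^tp_Ÿ) = Π^tp_Ÿ`, `φ(Δ_X) = Δ_X`, `χ ∘ aug ∘ φ = χ ∘ aug`, a coefficient automorphism `ψ ∈ Aut(μ_N)`, ONE
  theta cocycle `η''` with `ψ ∘ η = (η'' · (c ∘ aug)) ∘ φ` on `Π^tp_Ÿ` (`c` a continuous Kummer shift inflated
  from `G_K`: the `φ`-transform of `η` lies in the collection up to a `K^×`-twist) and an isomorphism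
  `M(η'') ≃ M(η)` over the identity of `Π^tp_Y` (Cor 2.18 (ii) for this pair), some `α ∈ Aut(M(η))` induces
  `φ|_{Π^tp_Y}`. Construction verbatim from abc-iut-L2-t10: `A₀ : (a, g) ↦ (ψ a, φ g)` normalises `D_Y` (shape
  lemmas of `Sec2AutOverProofs.lean`) and carries `Im(s^Θ_η)` to a Kummer shift of `Im(s^Θ_{η''})`.
* `…_of_comp_symm_mem` — the UNTWISTED case `ψ = 1`, `c = 1`: `η ∘ φ⁻¹|_{Π^tp_Ÿ}` is again a theta cocycle.
  The shape of the `{±1}`-part of Prop 2.14 (iii): the inversion acts by `+1` on `Δ_Θ` (Prop 2.2 (i), p.37)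
  and carries `η̈^Θ` to a `Gal(Ÿ/Y)`-conjugate ("`Θ̈(Ü⁻¹) = −Θ̈(Ü)`", "`Θ̈(−Ü) = −Θ̈(Ü)`", Prop 1.4 (ii), p.22).
* `…_of_augConj` — `φ` covering an INNER automorphism of `G_K` (`aug (φ x) = g₀·aug x·g₀⁻¹`; e.g. `φ` =
  conjugation by an element of `Π^tp_C ⊇ Π^tp_X`): `φ(Δ_X) = Δ_X`, `χ ∘ aug ∘ φ = χ ∘ aug` are then automatic.
* `RigidData.exists_monoIso_over_aut_of_cor218_ii` (+ `_of_comp_symm_mem`) — over `RigidData`, with the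
  iso from the named fact `Cor218_ii` (BY NAME; at the §1 model abc-iut-L2-t10's `cor218_ii_of_model`) and
  `χ`-invariance from the Cor 2.18 (i) clauses `φ(Ker(Π^tp_X ↠ (Π^tp_X)^Θ)) = Ker`, `φ(l·Δ_Θ) = l·Δ_Θ` for THIS
  `φ` (abc-iut-L2-t10's `chi_aug_invariant`). abc-iut-L2-t10's global theorem is the `∀ γ` composition.
HONEST FRAMING: [EtTh] is refereed; OUR kernel checks over the typed §2 interface; the cusp-LABEL clause of
Prop 2.14 (iii) (`RigidData.ActsOnCuspsBy`) is not addressed (label equivariance is interface input); no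
side is taken on [IUTchIII] Cor 3.12; typed ≠ discharged elsewhere.
-/

namespace Literature.AnabelianGeometry.EtaleTheta

universe u

namespace ThetaEnvData

variable {N : ℕ+} (T : ThetaEnvData.{u} N)

/-- Automorphisms of the cyclic group `μ_N` commute with the cyclotomic character (both are power
maps) — `ThetaEnvData`-level twin of abc-iut-L2-t10's `RigidData.mulEquiv_comm_chi`.
[cite: MochizukiEtTh2009, Cor 2.18(iv) p.61] -/
theorem mulEquiv_comm_chi (ψ : T.mu ≃* T.mu) (σ : T.G) (a : T.mu) :
    ψ (T.chi σ a) = T.chi σ (ψ a) := by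
  haveI := T.mu_cyclic
  obtain ⟨m, hm⟩ := MonoidHom.map_cyclic ψ.toMonoidHom
  have h1 : ψ (T.chi σ a) = (T.chi σ a) ^ m := hm _
  have h2 : ψ a = a ^ m := hm a
  rw [h1, h2, map_zpow]

/-- Transport of membership along an automorphism mapping a subgroup ONTO itself.
[cite: MochizukiEtTh2009, Cor 2.18(i) p.60] -/
theorem mem_and_symm_mem_of_map_eq (φ : T.PiX ≃ₜ* T.PiX) (H : Subgroup T.PiX)
    (hH : H.map φ.toMulEquiv.toMonoidHom = H) :
    (∀ g ∈ H, φ g ∈ H) ∧ ∀ g ∈ H, φ.symm g ∈ H := by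
  refine ⟨fun g hg => ?_, fun g hg => ?_⟩
  · rw [← hH]; exact ⟨g, hg, rfl⟩
  · have hg' : g ∈ H.map φ.toMulEquiv.toMonoidHom := by rw [hH]; exact hg
    obtain ⟨g₀, hg₀, hg₀eq⟩ := hg'
    rw [show φ.symm g = g₀ by rw [← hg₀eq]; exact φ.symm_apply_apply g₀]; exact hg₀

/-- An automorphism of `Π^tp_X` preserving `Δ_X = Ker(aug)` covers a self-map `τ` of `G_K` on `Π^tp_Y`
(`aug` is onto). [cite: MochizukiEtTh2009, Cor 2.18(i) p.60] -/
theorem exists_augMap_of_ker_stable (e : T.PiX ≃ₜ* T.PiX) (he : ∀ k ∈ T.aug.ker, e k ∈ T.aug.ker) :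
    ∃ τ : T.G → T.G, ∀ g : T.PiY, T.aug (e (g : T.PiX)) = τ (T.augY g) := by
  refine ⟨fun σ => T.aug (e (Classical.choose (T.aug_surjective σ))), fun g => ?_⟩
  have hp := Classical.choose_spec (T.aug_surjective (T.augY g))
  set p := Classical.choose (T.aug_surjective (T.augY g))
  have hk : p⁻¹ * (g : T.PiX) ∈ T.aug.ker := by
    rw [MonoidHom.mem_ker, map_mul, map_inv, hp]; exact inv_mul_cancel _
  have : (g : T.PiX) = p * (p⁻¹ * g) := by group
  change T.aug (e (g : T.PiX)) = T.aug (e p)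
  rw [this, map_mul, map_mul, (he _ hk), mul_one]

/-- **Prop 2.14 (iii) existence half / Cor 2.18 (iv) surjectivity, PER AUTOMORPHISM.** Let `φ` be a
bi-continuous automorphism of `Π^tp_X` with `φ(Π^tp_Y) = Π^tp_Y`, `φ(Π^tp_Ÿ) = Π^tp_Ÿ`, `φ(Δ_X) = Δ_X` and
`χ(aug(φ x)) = χ(aug x)`; let `ψ ∈ Aut(μ_N)`, and suppose the `(ψ, φ)`-transform of the theta cocycle `η`
is, up to a continuous Kummer shift `c` inflated from `G_K`, a theta cocycle `η''`
(`ψ(η(d)) = η''(φ d) · c(aug(φ d))`), and that `M(η'') ≃ M(η)` over the identity of `Π^tp_Y`. Then some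
automorphism of the model mono-theta environment `M(η) = (Π^tp_Y[μ_N], D_Y, s^Θ_η)` induces `φ` on
`Π^tp_Y`. (Construction of abc-iut-L2-t10's `cor218_iv_surjective_of`, localised.)
[cite: MochizukiEtTh2009, Prop 2.14(iii) p.50] -/
theorem exists_monoIso_over_aut {η : T.PiYdd → T.mu} (hη : η ∈ T.thetaCocycles)
    (φ : T.PiX ≃ₜ* T.PiX) (hY : T.PiY.map φ.toMulEquiv.toMonoidHom = T.PiY)
    (hdd : T.PiYdd.map φ.toMulEquiv.toMonoidHom = T.PiYdd)
    (hker : T.aug.ker.map φ.toMulEquiv.toMonoidHom = T.aug.ker)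
    (hχ : ∀ x : T.PiX, T.chi (T.aug (φ x)) = T.chi (T.aug x))
    (ψ : T.mu ≃* T.mu) {η'' : T.PiYdd → T.mu} (hη'' : η'' ∈ T.thetaCocycles)
    (c : T.G → T.mu) (hc : CycEnvelope.IsEnvCocycle T.augY T.chi (c ∘ T.augY))
    (hcc : CycEnvelope.shift hc ∈ contMulAut T.env)
    (hηc : ∀ d d' : T.PiYdd, φ (d : T.PiX) = d' → ψ (η d) = η'' d' * c (T.augY (T.inclYdd d')))
    (e : (T.modelMono hη'').Iso (T.modelMono hη))
    (he : ∀ x, CycEnvelope.proj T.augY T.chi (e.e x) = CycEnvelope.proj T.augY T.chi x) :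
    ∃ α : (T.modelMono hη).Iso (T.modelMono hη),
      ∀ x, ((CycEnvelope.proj T.augY T.chi (α.e x) : T.PiY) : T.PiX) =
        φ (CycEnvelope.proj T.augY T.chi x : T.PiY) := by
  -- adapted from abc-iut-L2-t10's `RigidData.cor218_iv_surjective_of` (Sec2LiftingSurjProofs.lean)
  have hψ : ∀ σ a, ψ (T.chi σ a) = T.chi σ (ψ a) := T.mulEquiv_comm_chi ψ
  have hψ' : ∀ σ a, ψ.symm (T.chi σ a) = T.chi σ (ψ.symm a) := T.mulEquiv_comm_chi ψ.symm
  have hχ' : ∀ x : T.PiX, T.chi (T.aug (φ.symm x)) = T.chi (T.aug x) := fun x => by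
    rw [← hχ (φ.symm x), ContinuousMulEquiv.apply_symm_apply]
  obtain ⟨hYm, hYm'⟩ := T.mem_and_symm_mem_of_map_eq φ _ hY
  obtain ⟨hddm, hddm'⟩ := T.mem_and_symm_mem_of_map_eq φ _ hdd
  obtain ⟨hkerm, hkerm'⟩ := T.mem_and_symm_mem_of_map_eq φ _ hker
  -- the automorphism `A₀ : (a, g) ↦ (ψ a, φ g)`
  let A₀ : MulAut T.env :=
    { toFun := fun x => ⟨ψ x.left, ⟨φ (x.right : T.PiX), hYm _ x.right.2⟩⟩
      invFun := fun x => ⟨ψ.symm x.left, ⟨φ.symm (x.right : T.PiX), hYm' _ x.right.2⟩⟩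
      left_inv := fun x => by ext <;> simp
      right_inv := fun x => by ext <;> simp
      map_mul' := fun x y => by
        ext
        · simp only [SemidirectProduct.mul_left, map_mul, MonoidHom.coe_comp,
            Function.comp_apply, Subgroup.coe_subtype]
          rw [hψ, hχ]
        · simp }
  have hl : ∀ x : T.env, (A₀ x).left = ψ x.left := fun x => rfl
  have hr : ∀ x : T.env, (((A₀ x).right : T.PiY) : T.PiX) = φ (x.right : T.PiX) := fun x => rfl
  -- continuity of `A₀`
  have hlc : Continuous fun x : T.env => x.left :=
    (continuous_fst.comp continuous_induced_dom :
      Continuous (Prod.fst ∘ fun x : T.env => (x.left, x.right)))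
  have hrc : Continuous fun x : T.env => ((x.right : T.PiY) : T.PiX) :=
    continuous_subtype_val.comp (continuous_snd.comp continuous_induced_dom :
      Continuous (Prod.snd ∘ fun x : T.env => (x.left, x.right)))
  have hA₀c : A₀ ∈ contMulAut T.env := by
    refine ⟨?_, ?_⟩
    · refine continuous_induced_rng.2 ?_
      change Continuous fun x : T.env =>
        ((ψ x.left, (⟨φ (x.right : T.PiX), hYm _ x.right.2⟩ : T.PiY)) : T.mu × T.PiY)
      exact ((continuous_of_discreteTopology (f := fun a : T.mu => ψ a)).comp hlc).prodMk
        ((φ.continuous.comp hrc).subtype_mk _)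
    · refine continuous_induced_rng.2 ?_
      change Continuous fun x : T.env =>
        ((ψ.symm x.left, (⟨φ.symm (x.right : T.PiX), hYm' _ x.right.2⟩ : T.PiY)) : T.mu × T.PiY)
      exact ((continuous_of_discreteTopology (f := fun a : T.mu => ψ.symm a)).comp hlc).prodMk
        ((φ.symm.continuous.comp hrc).subtype_mk _)
  set cA : contMulAut T.env := ⟨A₀, hA₀c⟩ with hcA
  -- `τ`, `τ'`: the maps induced by `φ⁻¹`, `φ` on `G_K`
  obtain ⟨τ, hτ⟩ := T.exists_augMap_of_ker_stable φ.symm hkerm'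
  obtain ⟨τ', hτ'⟩ := T.exists_augMap_of_ker_stable φ hkerm
  -- `A₀` normalises `D_Y`
  obtain ⟨hl', hr'⟩ := ThetaEnvData.inv_shape cA φ ψ hl hr
  have h1 := ThetaEnvData.DY_conj_gen_of_shape cA φ ψ hl hr hψ hχ τ hτ
  have h2' := ThetaEnvData.DY_conj_gen_of_shape cA⁻¹ φ.symm ψ.symm hl' hr' hψ' hχ' τ'
    (fun g => by rw [ContinuousMulEquiv.symm_symm]; exact hτ' g)
  have hD : T.DY.map (MulAut.conj (TopOut.mk _ cA)).toMonoidHom = T.DY := by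
    refine T.DY_map_conj_eq_of_generators cA h1 fun d hd => ?_
    have h := h2' d hd
    rwa [map_inv, inv_inv] at h
  -- the Kummer shift `S = α_{(c∘aug)⁻¹}` and the transport of `Im(s^Θ_η)`
  have hS : CycEnvelope.shift hc.inv ∈ contMulAut T.env := by
    rw [← CycEnvelope.shift_inv hc]; exact inv_mem hcc
  set cS : contMulAut T.env := ⟨_, hS⟩ with hcS
  have hcSinv : cS = (⟨_, hcc⟩ : contMulAut T.env)⁻¹ := Subtype.ext (CycEnvelope.shift_inv hc).symm
  have hst : ∀ d : T.PiYdd, A₀ (T.sTheta hη d) =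
      CycEnvelope.shift hc.inv (T.sTheta hη'' ⟨φ (d : T.PiX), hddm _ d.2⟩) := by
    intro d
    have hd := hηc d ⟨φ (d : T.PiX), hddm _ d.2⟩ rfl
    ext
    · change ψ (η d)⁻¹ = (η'' _)⁻¹ * (c (T.augY (T.inclYdd _)))⁻¹
      rw [map_inv, hd, mul_inv]
    · rfl
  have hrange : (T.sTheta hη).range.map (cA : MulAut T.env).toMonoidHom =
      (T.sTheta hη'').range.map (cS : MulAut T.env).toMonoidHom := by
    ext y
    constructor
    · rintro ⟨_, ⟨d, rfl⟩, rfl⟩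
      exact ⟨_, ⟨⟨φ (d : T.PiX), hddm _ d.2⟩, rfl⟩, (hst d).symm⟩
    · rintro ⟨_, ⟨d', rfl⟩, rfl⟩
      refine ⟨_, ⟨⟨φ.symm (d' : T.PiX), hddm' _ d'.2⟩, rfl⟩, ?_⟩
      change A₀ _ = _
      rw [hst]
      change _ = CycEnvelope.shift hc.inv (T.sTheta hη'' d')
      congr 2
      apply Subtype.ext
      exact ContinuousMulEquiv.apply_symm_apply φ (d' : T.PiX)
  -- the isomorphism `e : M(η'') ≃ M(η)` over the identity, and its `μ_N`-offset `m`
  set ce : contMulAut T.env := ⟨e.e.toMulEquiv, e.e.continuous, e.e.symm.continuous⟩ with hce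
  have hDe : T.DY.map (MulAut.conj (TopOut.mk _ ce)).toMonoidHom = T.DY := by
    have h := e.map_D
    change T.DY.map (TopOut.transport e.e) = T.DY at h
    rwa [TopOut.transport_eq_conj] at h
  have hecl : (T.sTheta hη'').range.map (ce : MulAut T.env).toMonoidHom ∈
      CycEnvelope.muConjClass T.augY T.chi (T.sTheta hη).range := by
    have h := e.map_sTheta
    change (fun H : Subgroup T.env => H.map e.e.toMulEquiv.toMonoidHom) ''
        CycEnvelope.muConjClass T.augY T.chi (T.sTheta hη'').range =
      CycEnvelope.muConjClass T.augY T.chi (T.sTheta hη).range at h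
    rw [← h]
    exact ⟨_, CycEnvelope.self_mem_muConjClass _ _ _, rfl⟩
  obtain ⟨m, hm⟩ := hecl
  have heright : ∀ y, (e.e y).right = y.right := he
  have heright' : ∀ y, (e.e.symm y).right = y.right := fun y => by
    have h := heright (e.e.symm y)
    rw [ContinuousMulEquiv.apply_symm_apply] at h
    exact h.symm
  -- the total automorphism
  set ct : contMulAut T.env := ce * cS⁻¹ * cA with hct
  have hDt : T.DY.map (MulAut.conj (TopOut.mk _ ct)).toMonoidHom = T.DY := by
    rw [hct, map_mul (TopOut.mk _), map_mul (TopOut.mk _), map_inv (TopOut.mk _)]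
    have hDS : T.DY.map (MulAut.conj (TopOut.mk _ cS)).toMonoidHom = T.DY := by
      rw [hcSinv, map_inv (TopOut.mk _)]
      exact (subgroup_map_conj_mul_inv _ (T.DY_map_conj_shift hc hcc)
        (T.DY_map_conj_shift hc hcc)).2
    exact (subgroup_map_conj_mul_inv _
      (subgroup_map_conj_mul_inv _ hDe (subgroup_map_conj_mul_inv _ hDS hDS).2).1 hD).1
  -- action on `μ_N`
  have hAμ : ∀ a, A₀ (CycEnvelope.inMu T.augY T.chi a) = CycEnvelope.inMu T.augY T.chi (ψ a) :=
    fun a => by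
    ext
    · rfl
    · change φ ((1 : T.PiY) : T.PiX) = ((1 : T.PiY) : T.PiX); rw [Subgroup.coe_one, map_one]
  have hSμ : ∀ a, (cS : MulAut T.env)⁻¹ (CycEnvelope.inMu T.augY T.chi a) =
      CycEnvelope.inMu T.augY T.chi a := fun a => by
    rw [hcSinv, Subgroup.coe_inv, inv_inv]; exact CycEnvelope.shift_inMu hc a
  have heμ : ∀ a, e.e (CycEnvelope.inMu T.augY T.chi a) =
      CycEnvelope.inMu T.augY T.chi (e.e (CycEnvelope.inMu T.augY T.chi a)).left := fun a => by
    ext <;> simp [heright]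
  have heμ' : ∀ a, e.e.symm (CycEnvelope.inMu T.augY T.chi a) =
      CycEnvelope.inMu T.augY T.chi (e.e.symm (CycEnvelope.inMu T.augY T.chi a)).left := fun a => by
    ext <;> simp [heright']
  have hμ : ∀ a, ∃ b, (ct : MulAut T.env) (CycEnvelope.inMu T.augY T.chi a) =
      CycEnvelope.inMu T.augY T.chi b := by
    intro a
    refine ⟨(e.e (CycEnvelope.inMu T.augY T.chi (ψ a))).left, ?_⟩
    rw [hct]
    change e.e ((cS : MulAut T.env)⁻¹ (A₀ _)) = _
    rw [hAμ, hSμ]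
    exact heμ (ψ a)
  have hμ' : ∀ b, ∃ a, (ct : MulAut T.env) (CycEnvelope.inMu T.augY T.chi a) =
      CycEnvelope.inMu T.augY T.chi b := by
    intro b
    refine ⟨ψ.symm (e.e.symm (CycEnvelope.inMu T.augY T.chi b)).left, ?_⟩
    rw [hct]
    change e.e ((cS : MulAut T.env)⁻¹ (A₀ _)) = _
    rw [hAμ, MulEquiv.apply_symm_apply, hSμ, ← heμ', ContinuousMulEquiv.apply_symm_apply]
  -- action on `Im(s^Θ_η)`
  have hone : ∀ (H : Subgroup T.env) (A : MulAut T.env),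
      (H.map A.toMonoidHom).map A⁻¹.toMonoidHom = H := by
    intro H A
    rw [← subgroup_map_mulAut_mul, inv_mul_cancel]
    exact Subgroup.map_id H
  have hs : (T.sTheta hη).range.map (ct : MulAut T.env).toMonoidHom =
      (T.sTheta hη).range.map
        (MulAut.conj (CycEnvelope.inMu T.augY T.chi m)).toMonoidHom := by
    rw [hct, Subgroup.coe_mul, Subgroup.coe_mul, Subgroup.coe_inv, subgroup_map_mulAut_mul, hrange,
      subgroup_map_mulAut_mul, hone]
    exact hm
  -- the total automorphism lies over `φ`
  have hproj : ∀ x, (((CycEnvelope.proj T.augY T.chi ((ct : MulAut T.env) x) : T.PiY) : T.PiX)) =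
      φ ((CycEnvelope.proj T.augY T.chi x : T.PiY) : T.PiX) := by
    intro x
    rw [hct]
    change (((e.e (((cS : MulAut T.env)⁻¹) (A₀ x))).right : T.PiY) : T.PiX) = φ (x.right : T.PiX)
    have h2 : ∀ y : T.env, ((cS : MulAut T.env)⁻¹ y).right = y.right := fun y => by
      rw [hcSinv, Subgroup.coe_inv, inv_inv]; rfl
    rw [heright, h2]; rfl
  obtain ⟨α, hα⟩ := T.exists_modelIso_of_aut'' hη hη ct hDt hμ hμ' m hs
  exact ⟨α, fun x => by rw [hα]; exact hproj x⟩

/-- **The untwisted case** (`ψ = 1`, no Kummer shift): if `φ ∈ Aut_top(Π^tp_X)` preserves `Π^tp_Y`,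
`Π^tp_Ÿ`, `Δ_X` and `χ ∘ aug`, and `η ∘ φ⁻¹|_{Π^tp_Ÿ}` is again a theta cocycle whose model is isomorphic
to `M(η)` over the identity, then `φ|_{Π^tp_Y}` lifts to `Aut(M(η))`. The shape of the `{±1}`-part of
Prop 2.14 (iii): the inversion acts by `+1` on `Δ_Θ` (Prop 2.2 (i)) and carries `η̈^Θ` to a
`Gal(Ÿ/Y)`-conjugate (Prop 1.4 (ii): "`Θ̈(Ü⁻¹) = −Θ̈(Ü)`", "`Θ̈(−Ü) = −Θ̈(Ü)`"), i.e. into the collection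
`η̈^{Θ,l·ℤ×μ₂}`. [cite: MochizukiEtTh2009, Prop 2.14(iii) p.50] -/
theorem exists_monoIso_over_aut_of_comp_symm_mem {η : T.PiYdd → T.mu} (hη : η ∈ T.thetaCocycles)
    (φ : T.PiX ≃ₜ* T.PiX) (hY : T.PiY.map φ.toMulEquiv.toMonoidHom = T.PiY)
    (hdd : T.PiYdd.map φ.toMulEquiv.toMonoidHom = T.PiYdd)
    (hker : T.aug.ker.map φ.toMulEquiv.toMonoidHom = T.aug.ker)
    (hχ : ∀ x : T.PiX, T.chi (T.aug (φ x)) = T.chi (T.aug x))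
    (hmem : (fun d : T.PiYdd => η ⟨φ.symm (d : T.PiX),
      (T.mem_and_symm_mem_of_map_eq φ _ hdd).2 _ d.2⟩) ∈ T.thetaCocycles)
    (e : (T.modelMono hmem).Iso (T.modelMono hη))
    (he : ∀ x, CycEnvelope.proj T.augY T.chi (e.e x) = CycEnvelope.proj T.augY T.chi x) :
    ∃ α : (T.modelMono hη).Iso (T.modelMono hη),
      ∀ x, ((CycEnvelope.proj T.augY T.chi (α.e x) : T.PiY) : T.PiX) =
        φ (CycEnvelope.proj T.augY T.chi x : T.PiY) := by
  have hc1 : CycEnvelope.IsEnvCocycle T.augY T.chi ((fun _ : T.G => (1 : T.mu)) ∘ T.augY) :=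
    fun g h => by simp
  have hsh1 : CycEnvelope.shift hc1 = 1 := MulEquiv.ext fun x => by
    rw [CycEnvelope.shift_apply]; ext <;> simp
  have hcc1 : CycEnvelope.shift hc1 ∈ contMulAut T.env := by rw [hsh1]; exact one_mem _
  refine T.exists_monoIso_over_aut hη φ hY hdd hker hχ (MulEquiv.refl _) hmem (fun _ => 1) hc1 hcc1
    (fun d d' hdd' => ?_) e he
  have hd : (⟨φ.symm (d' : T.PiX), (T.mem_and_symm_mem_of_map_eq φ _ hdd).2 _ d'.2⟩ : T.PiYdd) = d := by
    apply Subtype.ext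
    change φ.symm (d' : T.PiX) = (d : T.PiX)
    rw [← hdd', ContinuousMulEquiv.symm_apply_apply]
  simp only [MulEquiv.refl_apply, mul_one]
  rw [hd]

/-- **Variant: `φ` covers an inner automorphism of `G_K`** (`aug (φ x) = g₀ · aug x · g₀⁻¹` — e.g. `φ` is
the restriction to `Π^tp_X` of conjugation by an element of `Π^tp_C`, the inversion of `C = X/{±1}`):
then `φ(Δ_X) = Δ_X` and `χ(aug(φ x)) = χ(aug x)` hold automatically (`Aut(μ_N)` is commutative), so only
the subgroup clauses, the theta-stability datum and Cor 2.18 (ii) for the pair remain.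
[cite: MochizukiEtTh2009, Prop 2.14(iii) p.50] -/
theorem exists_monoIso_over_aut_of_augConj {η : T.PiYdd → T.mu} (hη : η ∈ T.thetaCocycles)
    (φ : T.PiX ≃ₜ* T.PiX) (hY : T.PiY.map φ.toMulEquiv.toMonoidHom = T.PiY)
    (hdd : T.PiYdd.map φ.toMulEquiv.toMonoidHom = T.PiYdd)
    (g₀ : T.G) (haug : ∀ x : T.PiX, T.aug (φ x) = g₀ * T.aug x * g₀⁻¹)
    (ψ : T.mu ≃* T.mu) {η'' : T.PiYdd → T.mu} (hη'' : η'' ∈ T.thetaCocycles)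
    (c : T.G → T.mu) (hc : CycEnvelope.IsEnvCocycle T.augY T.chi (c ∘ T.augY))
    (hcc : CycEnvelope.shift hc ∈ contMulAut T.env)
    (hηc : ∀ d d' : T.PiYdd, φ (d : T.PiX) = d' → ψ (η d) = η'' d' * c (T.augY (T.inclYdd d')))
    (e : (T.modelMono hη'').Iso (T.modelMono hη))
    (he : ∀ x, CycEnvelope.proj T.augY T.chi (e.e x) = CycEnvelope.proj T.augY T.chi x) :
    ∃ α : (T.modelMono hη).Iso (T.modelMono hη),
      ∀ x, ((CycEnvelope.proj T.augY T.chi (α.e x) : T.PiY) : T.PiX) =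
        φ (CycEnvelope.proj T.augY T.chi x : T.PiY) := by
  have haug' : ∀ x : T.PiX, T.aug (φ.symm x) = g₀⁻¹ * T.aug x * g₀ := fun x => by
    have h := haug (φ.symm x)
    rw [ContinuousMulEquiv.apply_symm_apply] at h
    rw [h]; group
  have hker : T.aug.ker.map φ.toMulEquiv.toMonoidHom = T.aug.ker := by
    ext k
    constructor
    · rintro ⟨k₀, hk₀, rfl⟩
      have hk₀' : T.aug k₀ = 1 := hk₀
      change T.aug (φ k₀) = 1
      rw [haug, hk₀', mul_one, mul_inv_cancel]
    · intro hk
      have hk' : T.aug k = 1 := hk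
      refine ⟨φ.symm k, ?_, φ.apply_symm_apply k⟩
      change T.aug (φ.symm k) = 1
      rw [haug', hk', mul_one, inv_mul_cancel]
  have hχ : ∀ x : T.PiX, T.chi (T.aug (φ x)) = T.chi (T.aug x) := fun x => by
    rw [haug, map_mul, map_mul, map_inv]
    apply MulEquiv.ext
    intro a
    rw [MulAut.mul_apply, MulAut.mul_apply, T.mulEquiv_comm_chi (T.chi g₀) (T.aug x)]
    congr 1
    rw [← MulAut.mul_apply, mul_inv_cancel, MulAut.one_apply]
  exact T.exists_monoIso_over_aut hη φ hY hdd hker hχ ψ hη'' c hc hcc hηc e he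

end ThetaEnvData

namespace RigidData

variable {N : ℕ+} {l : ℕ} (R : RigidData.{u} N l)

/-- **Prop 2.14 (iii) existence half, per automorphism, over `RigidData` with Cor 2.18 (ii) BY NAME**:
the isomorphism `M(η'') ≃ M(η)` over the identity is supplied by the named fact `Cor218_ii` (at the §1
model: abc-iut-L2-t10's `cor218_ii_of_model`), and the `χ`-invariance by the Cor 2.18 (i) clauses for THIS
`φ` — `φ` preserves `Ker(Π^tp_X ↠ (Π^tp_X)^Θ)` and `l·Δ_Θ` (abc-iut-L2-t10's `chi_aug_invariant`).
[cite: MochizukiEtTh2009, Prop 2.14(iii) p.50] -/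
theorem exists_monoIso_over_aut_of_cor218_ii (h218ii : R.Cor218_ii)
    {η : R.PiYdd → R.mu} (hη : η ∈ R.thetaCocycles)
    (φ : R.PiX ≃ₜ* R.PiX) (hY : R.PiY.map φ.toMulEquiv.toMonoidHom = R.PiY)
    (hdd : R.PiYdd.map φ.toMulEquiv.toMonoidHom = R.PiYdd)
    (hker : R.aug.ker.map φ.toMulEquiv.toMonoidHom = R.aug.ker)
    (hK : R.thetaKer.map φ.toMulEquiv.toMonoidHom = R.thetaKer)
    (hL : R.lDeltaTheta.map φ.toMulEquiv.toMonoidHom = R.lDeltaTheta)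
    (ψ : R.mu ≃* R.mu) {η'' : R.PiYdd → R.mu} (hη'' : η'' ∈ R.thetaCocycles)
    (c : R.G → R.mu) (hc : CycEnvelope.IsEnvCocycle R.augY R.chi (c ∘ R.augY))
    (hcc : CycEnvelope.shift hc ∈ contMulAut R.env)
    (hηc : ∀ d d' : R.PiYdd, φ (d : R.PiX) = d' → ψ (η d) = η'' d' * c (R.augY (R.inclYdd d'))) :
    ∃ α : (R.modelMono hη).Iso (R.modelMono hη),
      ∀ x, ((CycEnvelope.proj R.augY R.chi (α.e x) : R.PiY) : R.PiX) =
        φ (CycEnvelope.proj R.augY R.chi x : R.PiY) := by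
  obtain ⟨e, he⟩ := h218ii η'' η hη'' hη
  exact R.toThetaEnvData.exists_monoIso_over_aut hη φ hY hdd hker (R.chi_aug_invariant φ hK hL) ψ hη''
    c hc hcc hηc e he

/-- **The untwisted case over `RigidData`**: `η ∘ φ⁻¹ ∈` the collection and Cor 2.18 (ii) BY NAME give
a lift of `φ|_{Π^tp_Y}` to `Aut(M(η))` — the `{±1}`-shape of Prop 2.14 (iii).
[cite: MochizukiEtTh2009, Prop 2.14(iii) p.50] -/
theorem exists_monoIso_over_aut_of_comp_symm_mem (h218ii : R.Cor218_ii)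
    {η : R.PiYdd → R.mu} (hη : η ∈ R.thetaCocycles)
    (φ : R.PiX ≃ₜ* R.PiX) (hY : R.PiY.map φ.toMulEquiv.toMonoidHom = R.PiY)
    (hdd : R.PiYdd.map φ.toMulEquiv.toMonoidHom = R.PiYdd)
    (hker : R.aug.ker.map φ.toMulEquiv.toMonoidHom = R.aug.ker)
    (hK : R.thetaKer.map φ.toMulEquiv.toMonoidHom = R.thetaKer)
    (hL : R.lDeltaTheta.map φ.toMulEquiv.toMonoidHom = R.lDeltaTheta)
    (hmem : (fun d : R.PiYdd => η ⟨φ.symm (d : R.PiX),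
      (R.toThetaEnvData.mem_and_symm_mem_of_map_eq φ _ hdd).2 _ d.2⟩) ∈ R.thetaCocycles) :
    ∃ α : (R.modelMono hη).Iso (R.modelMono hη),
      ∀ x, ((CycEnvelope.proj R.augY R.chi (α.e x) : R.PiY) : R.PiX) =
        φ (CycEnvelope.proj R.augY R.chi x : R.PiY) := by
  obtain ⟨e, he⟩ := h218ii _ η hmem hη
  exact R.toThetaEnvData.exists_monoIso_over_aut_of_comp_symm_mem hη φ hY hdd hker
    (R.chi_aug_invariant φ hK hL) hmem e he

end RigidData

end Literature.AnabelianGeometry.EtaleTheta
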